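import Literature.Probability.RandomPlanarGeometry.Curve
import Literature.Probability.RandomPlanarGeometry.CurveSpace
import Literature.Probability.LatticeModels.DobrushinDiscretisation
import HarnessLib

/-!
# Percolation exploration interfaces as planar curves (fact-free vocabulary)

Topic `Literature/Probability/Percolation`; definition request `defn-ZdDiscretisationFamily-2`
(route repair of `CriticalPhenomena/CardyFormulaZ2/CardyComplexCone`; serves the seven
`CardyFormulaZ2` routes `CardyComplexCone`, `CardySusyWard`, `CardyWindingIG`,
`CardyDualCurrent`, `CardySublatticeCoherence`, `CardyViaSLE6`, `CardyRotToConf`).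

The model-independent vocabulary with which the scaling-limit statements for the percolation
exploration interface in a Dobrushin domain `(Ω; a, b)` are written (S. Smirnov, *Towards
conformal invariance of 2D lattice models*, ICM 2006, §2.1: lattice approximations of `(Ω; a, b)`,
Dobrushin boundary conditions, the interface from `a` to `b` as a random curve for the sup–inf
metric; F. Camia, C. M. Newman, PTRF 139 (2007), §2 and §4.1; S. Smirnov, C. R. Acad. Sci. 333
(2001), §2):

## Contents (namespace `Literature.Probability.Percolation.Interface`, exported to
`Literature.Probability.Percolation`)

* `dobrushinData D δ : DiscreteDobrushin := ⟨D.carrier, δ, D.arc 0, D.arc 1⟩` — the canonical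
  G02 discrete Dobrushin data of `(D; a, b)` at mesh `δ` (arc `(ab)` open / wired, arc `(ba)`
  closed / dual-wired); `dobrushinData_Ω/_δ/_arcA/_arcB`;
* `reverseCurve γ` — time reversal `t ↦ γ (1 - t)` of a parametrised curve;
  `reverseCurve_apply`, `reverseCurve_reverseCurve`;
* `orientCurve D γ : Curve ℂ` — the endpoint rule re-orienting a discrete interface so that it
  runs from (near) `a` to (near) `b`; `orientCurve_of_le/_of_lt/_eq_or`, `range_orientCurve`;
* `triInterface D δ ω`, `bondInterface D δ ω : CurveClass ℂ` — the classes of G02's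
  (re-oriented) hexagonal, resp. medial, exploration curve of the canonical data;
  `triInterface_apply`, `bondInterface_apply`, `range_triInterface`, `range_bondInterface`;
* `bondInterfaceIn D E ω : CurveClass ℂ` — the same for a general discrete Dobrushin domain `E`
  discretising `D` (the interface map of the family forms of the scaling-limit statements,
  together with `LatticeModels.ZdDiscretisationFamily D E` of `DobrushinDiscretisation.lean`);
  `bondInterfaceIn_apply`, `bondInterfaceIn_dobrushinData`, `range_bondInterfaceIn`;
* `zdDiscretisationFamily_dobrushinData_iff` — the canonical data form a
  `ZdDiscretisationFamily` iff they are eventually admissible with convergent marked points.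

## Why this file exists, and how the old names keep working (read before deduplicating)

These are the local definitions of `Literature/Probability/Percolation/InterfaceScalingLimit.lean`
(`dobrushinData`, `reverseCurve`, `orientCurve`, `triInterface`, `bondInterface` and their API
lemmas) and of `InterfaceScalingLimitDiscretised.lean` (`bondInterfaceIn`, `bondInterfaceIn_apply`,
`bondInterfaceIn_dobrushinData`, `range_bondInterfaceIn`, `zdDiscretisationFamily_dobrushinData_iff`),
reproduced **verbatim** — same bodies, same statements, same docstrings up to cross-references,
same `simp` attributes — in a module whose Literature import closure contains **no unproved named
fact**: it imports only `RandomPlanarGeometry.Curve`/`CurveSpace` (`Curve`, `CurveClass`; no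
named facts) and `LatticeModels.DobrushinDiscretisation` (`ZdDiscretisationFamily`, hence
`MedialInterface`, `LatticeInterface`, `PlanarDomains`, all of whose named facts are discharged or
belong to the import cone of `Summits.CriticalPhenomena.Statement`). By contrast
`InterfaceScalingLimit.lean` *states*, next to this vocabulary, the named facts
`aemeasurable_bondInterface` (XL), `convergesInLawToSLE_six_triInterface` (Camia–Newman, XL) and the
OPEN CONJECTURE `SLE6LimitZ2` (crit-perc.S02, undischargeable by construction), so that every
route file importing it for the vocabulary alone carried those three in its import cone
(`blocked-by-cone`). Route files now import this module (and `LatticeModels.MedialWinding` for the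
parafermionic passage sum) and state their cruxes — e.g. the SLE₆ limit in family form,
`∀ D E, ZdDiscretisationFamily D E → ConvergesInLawToSLE 6 D (fun δ ↦ bondInterfaceIn D (E δ))
(fun _ ↦ bondPercolation (zdGraph 2) half)`, which is `SLE6LimitZ2AllDiscretisations` unfolded —
with bundled notions and a clean cone. (No named fact and no conjecture is restated here: a copy
of `SLE6LimitZ2AllDiscretisations` would be one more undischargeable entry of the facts census;
the displayed unfolding is certified `Iff.rfl` in the bridge file that imports both sides.)

Same mechanism as `LatticeModels/PolylineWinding.lean`: the declarations live in the
sub-namespace `…Percolation.Interface` (one fully-qualified name, one module — the two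
`InterfaceScalingLimit*` files still declare `…Percolation.dobrushinData` etc. themselves), and
the `export Interface (…)` command at the end registers the OLD names
`Literature.Probability.Percolation.dobrushinData`, `….orientCurve`, `….bondInterface`,
`….bondInterfaceIn`, … as *aliases* (Lean's alias table travels with `import`). Hence a route or
proof file written against `InterfaceScalingLimit` — fully qualified (as the gate renders Theses
files), under `open Literature.Probability.Percolation`, or inside that namespace — elaborates
UNCHANGED against this module once its import points here. A module importing **both** this file
and `InterfaceScalingLimit` sees the real constants and the aliases: fully-qualified references
then resolve to the real (`InterfaceScalingLimit`) constants, SHORT references are reported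
ambiguous by Lean (an error naming both candidates, never a silent change); such a file writes
`Interface.bondInterface`. No module does this today. The two copies agree definitionally
(`Interface.bondInterfaceIn = bondInterfaceIn` etc. by `rfl`, recorded in a bridge file importing
both; not needed by the routes). The duplicates to delete eventually are the blocks in the two
`InterfaceScalingLimit*` files (an operator-side atomic change, gate lint
`removes-referenced-decl`), **not** this file.

## Design choices (as in `InterfaceScalingLimit`)

* **Orientation (`orientCurve`).** G02 orients both exploration paths by "open / arc-`A` sites
  on the left", while `MarkedDomain` does not fix the orientation of the boundary loop; chordal
  SLE_κ (`IsSLECurve κ D`) runs from `a = D.pt 0` to `b = D.pt 1` and `CurveClass ℂ` remembers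
  orientation, so each discrete interface is re-oriented by the endpoint rule: keep the curve if
  its starting point is at least as close to `a` as to `b`, time-reverse it otherwise. As the
  interface joins the discrete marked points `a_δ → a`, `b_δ → b`, this is the `a → b`
  orientation for all small `δ`.
* **Junk.** G02's exploration curves are the constant curve `0` unless the exploration path is
  uniquely defined, which admissibility of the data guarantees (`IsZdAdmissible`, resp.
  `IsAdmissible` on `δ𝕋`); the canonical data `dobrushinData D δ` fail to be admissible at tie
  sites of the distance recipe `zdDiscreteArc` (e.g. on the unit disc at every mesh,
  `CanonicalDiscretisationTies.lean`), which is why the family forms quantify over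
  `ZdDiscretisationFamily D E` and use `bondInterfaceIn D (E δ)`.
* **Boundary conditions on `δℤ²`.** G02's `bcBondConfig` wires the arc `(ab)` and *closes* every
  edge touching the discrete arc of `(ba)` (dual-wired together with the outside) rather than
  leaving `(ba)` free; same scaling limit (docstring of `DiscreteDobrushin.bcBondConfig`).

Mathlib: `unitInterval.symm`/`continuous_symm`/`symm_bijective` (time reversal),
`ContinuousMap.comp`, `Metric.hausdorffEDist`, `nhdsWithin`; Mathlib has no percolation
interface or curve-space notion (see `CurveSpace`).

## References

* S. Smirnov, *Towards conformal invariance of 2D lattice models*, Proc. ICM 2006, Vol. II,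
  1421–1451 (arXiv:0708.0032), §2.1. [Smirnov2007ICM]
* S. Smirnov, *Critical percolation in the plane*, C. R. Acad. Sci. Paris 333 (2001), §2.
  [Smirnov2001]
* F. Camia, C. M. Newman, *Critical percolation exploration path and SLE₆: a proof of
  convergence*, Probab. Theory Related Fields 139 (2007), §2, §4.1. [CamiaNewman2007]
* M. Aizenman, A. Burchard, *Hölder regularity and dimension bounds for random curves*, Duke
  Math. J. 99 (1999), §2.1 (curves modulo reparametrisation, time reversal). [AizenmanBurchard1999]
* D. Chelkak, H. Duminil-Copin, C. Hongler, A. Kemppainen, S. Smirnov, C. R. Math. 352 (2014),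
  §1 (discrete Dobrushin approximations). [CDHKSCRAS2014]
-/

noncomputable section

open Filter
open _root_.Topology
open scoped unitInterval

namespace Literature.Probability.Percolation.Interface

open LatticeModels RandomPlanarGeometry

/-! ### Discrete Dobrushin data -/

/-- The discrete Dobrushin data of the Dobrushin domain `(D; a, b)` at mesh `δ`: the domain
`D.carrier`, the mesh `δ`, the arc `A = D.arc 0` (from `a = D.pt 0` to `b = D.pt 1`, carrying
the open / wired boundary condition) and the arc `B = D.arc 1` (from `b` to `a`, closed /
dual-wired). Verbatim copy of `InterfaceScalingLimit`'s `dobrushinData` (same recipe as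
`LatticeModels.dobrushinData` of `InterfaceSLE`). (Smirnov 2001, §2; Camia–Newman 2007, §2;
CDHKS 2014, §1.) [cite: Smirnov2001, §2] -/
def dobrushinData (D : DobrushinDomain) (δ : ℝ) : DiscreteDobrushin :=
  ⟨D.carrier, δ, D.arc 0, D.arc 1⟩

/-- The domain of `dobrushinData D δ` is `D.carrier`. (Smirnov 2001, §2.) [cite: Smirnov2001, §2] -/
@[simp] theorem dobrushinData_Ω (D : DobrushinDomain) (δ : ℝ) :
    (dobrushinData D δ).Ω = D.carrier := rfl

/-- The mesh of `dobrushinData D δ` is `δ`. (Smirnov 2001, §2.) [cite: Smirnov2001, §2] -/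
@[simp] theorem dobrushinData_δ (D : DobrushinDomain) (δ : ℝ) : (dobrushinData D δ).δ = δ := rfl

/-- The open / wired arc of `dobrushinData D δ` is `D.arc 0` (from `a` to `b`).
(Smirnov 2001, §2.) [cite: Smirnov2001, §2] -/
@[simp] theorem dobrushinData_arcA (D : DobrushinDomain) (δ : ℝ) :
    (dobrushinData D δ).arcA = D.arc 0 := rfl

/-- The closed / dual-wired arc of `dobrushinData D δ` is `D.arc 1` (from `b` to `a`).
(Smirnov 2001, §2.) [cite: Smirnov2001, §2] -/
@[simp] theorem dobrushinData_arcB (D : DobrushinDomain) (δ : ℝ) :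
    (dobrushinData D δ).arcB = D.arc 1 := rfl

/-! ### Orientation of discrete interfaces -/

/-- Time reversal of a parametrised curve `[0, 1] → E`: `t ↦ γ (1 - t)` (Mathlib's
`unitInterval.symm`; the analogue of `Path.symm` for unbased curves). Verbatim copy of
`InterfaceScalingLimit`'s `reverseCurve`. (Aizenman–Burchard 1999, §2.1.)
[cite: AizenmanBurchard1999, §2.1] -/
def reverseCurve {E : Type*} [TopologicalSpace E] (γ : C(I, E)) : C(I, E) :=
  γ.comp ⟨σ, unitInterval.continuous_symm⟩

/-- `reverseCurve γ t = γ (1 - t)`. (Aizenman–Burchard 1999, §2.1.)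
[cite: AizenmanBurchard1999, §2.1] -/
@[simp] theorem reverseCurve_apply {E : Type*} [TopologicalSpace E] (γ : C(I, E)) (t : I) :
    reverseCurve γ t = γ (σ t) := rfl

/-- Time reversal is an involution. (Aizenman–Burchard 1999, §2.1.)
[cite: AizenmanBurchard1999, §2.1] -/
@[simp] theorem reverseCurve_reverseCurve {E : Type*} [TopologicalSpace E] (γ : C(I, E)) :
    reverseCurve (reverseCurve γ) = γ := by
  ext t
  simp

/-- **Endpoint rule.** Re-orient a parametrised planar curve so that it runs from (near)
`a = D.pt 0` to (near) `b = D.pt 1`: keep `γ` if its starting point `γ 0` is at least as close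
to `a` as to `b`, time-reverse it otherwise. Needed because G02 orients exploration paths by
"arc `A` on the left" while `MarkedDomain` does not fix the orientation of the boundary loop,
whereas chordal SLE_κ (`IsSLECurve`) runs from `a` to `b` and `CurveClass ℂ` remembers
orientation. Verbatim copy of `InterfaceScalingLimit`'s `orientCurve`. (Camia–Newman 2007, §2:
the exploration path from `a_δ` to `b_δ`.) [cite: CamiaNewman2007, §2] -/
def orientCurve (D : DobrushinDomain) (γ : C(I, ℂ)) : Curve ℂ :=
  if dist (γ 0) (D.pt 0) ≤ dist (γ 0) (D.pt 1) then ⟨γ⟩ else ⟨reverseCurve γ⟩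

/-- A curve starting at least as close to `a` as to `b` is already oriented.
(Camia–Newman 2007, §2.) [cite: CamiaNewman2007, §2] -/
theorem orientCurve_of_le (D : DobrushinDomain) {γ : C(I, ℂ)}
    (h : dist (γ 0) (D.pt 0) ≤ dist (γ 0) (D.pt 1)) : orientCurve D γ = ⟨γ⟩ := by
  simp [orientCurve, h]

/-- A curve starting closer to `b` than to `a` is time-reversed. (Camia–Newman 2007, §2.)
[cite: CamiaNewman2007, §2] -/
theorem orientCurve_of_lt (D : DobrushinDomain) {γ : C(I, ℂ)}
    (h : dist (γ 0) (D.pt 1) < dist (γ 0) (D.pt 0)) : orientCurve D γ = ⟨reverseCurve γ⟩ := by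
  simp [orientCurve, not_le.2 h]

/-- `orientCurve D γ` is `γ` or its time reversal. (Camia–Newman 2007, §2.)
[cite: CamiaNewman2007, §2] -/
theorem orientCurve_eq_or (D : DobrushinDomain) (γ : C(I, ℂ)) :
    orientCurve D γ = ⟨γ⟩ ∨ orientCurve D γ = ⟨reverseCurve γ⟩ := by
  by_cases h : dist (γ 0) (D.pt 0) ≤ dist (γ 0) (D.pt 1) <;> simp [orientCurve, h]

/-- Re-orientation does not change the trace of the curve. (Aizenman–Burchard 1999, §2.1.)
[cite: AizenmanBurchard1999, §2.1] -/
theorem range_orientCurve (D : DobrushinDomain) (γ : C(I, ℂ)) :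
    (orientCurve D γ).range = Set.range γ := by
  rcases orientCurve_eq_or D γ with h | h <;> rw [h]
  · rfl
  · change Set.range (fun t ↦ γ (σ t)) = Set.range γ
    exact unitInterval.symm_bijective.surjective.range_comp γ

/-! ### The interfaces of the canonical data as curve classes -/

/-- The **site-percolation interface** on `δ𝕋` in the Dobrushin domain `D`: the class, in the
space `CurveClass ℂ` of planar curves modulo reparametrisation, of G02's polygonal hexagonal
exploration curve `explorationCurve (dobrushinData D δ) ω` (open / arc-`A` hexagons on its left,
closed / arc-`B` hexagons on its right; junk constant curve `0` if the exploration path is not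
uniquely defined), re-oriented to run from `a_δ` to `b_δ` (`orientCurve`). Verbatim copy of
`InterfaceScalingLimit`'s `triInterface`. (Smirnov 2001, §2; Camia–Newman 2007, §2.)
[cite: Smirnov2001, §2] -/
def triInterface (D : DobrushinDomain) (δ : ℝ) (ω : SiteConfig (Site 2)) : CurveClass ℂ :=
  CurveClass.mk (orientCurve D (explorationCurve (dobrushinData D δ) ω))

/-- The **bond-percolation interface** on `δℤ²` in the Dobrushin domain `D`: the class in
`CurveClass ℂ` of G02's polygonal medial exploration curve
`medialExplorationCurve (dobrushinData D δ) ω`, separating the open cluster of the (wired) arc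
`A` on its left from the dual-open cluster of the (dual-wired) arc `B` on its right (junk
constant curve `0` if the medial exploration path is not uniquely defined, in particular
whenever `dobrushinData D δ` is not `IsZdAdmissible`), re-oriented to run from `a_δ` to `b_δ`
(`orientCurve`). Verbatim copy of `InterfaceScalingLimit`'s `bondInterface`. (Smirnov 2001, §2,
square-lattice version; Smirnov, ICM 2006, §2.1; Grimmett 1999, §11.2.) [cite: Smirnov2001, §2] -/
def bondInterface (D : DobrushinDomain) (δ : ℝ) (ω : BondConfig (Site 2)) : CurveClass ℂ :=
  CurveClass.mk (orientCurve D (medialExplorationCurve (dobrushinData D δ) ω))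

/-- Unfolding `triInterface`. (Camia–Newman 2007, §2.) [cite: CamiaNewman2007, §2] -/
theorem triInterface_apply (D : DobrushinDomain) (δ : ℝ) (ω : SiteConfig (Site 2)) :
    triInterface D δ ω = CurveClass.mk (orientCurve D (explorationCurve (dobrushinData D δ) ω)) :=
  rfl

/-- Unfolding `bondInterface`. (Smirnov 2001, §2.) [cite: Smirnov2001, §2] -/
theorem bondInterface_apply (D : DobrushinDomain) (δ : ℝ) (ω : BondConfig (Site 2)) :
    bondInterface D δ ω =
      CurveClass.mk (orientCurve D (medialExplorationCurve (dobrushinData D δ) ω)) :=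
  rfl

/-- The trace of the triangular interface is the trace of G02's exploration curve
(re-orientation and passage to `CurveClass` do not change it). (Camia–Newman 2007, §2.)
[cite: CamiaNewman2007, §2] -/
theorem range_triInterface (D : DobrushinDomain) (δ : ℝ) (ω : SiteConfig (Site 2)) :
    (triInterface D δ ω).range = Set.range (explorationCurve (dobrushinData D δ) ω) := by
  rw [triInterface, CurveClass.range_mk, range_orientCurve]

/-- The trace of the bond interface is the trace of G02's medial exploration curve.
(Smirnov 2001, §2.) [cite: Smirnov2001, §2] -/
theorem range_bondInterface (D : DobrushinDomain) (δ : ℝ) (ω : BondConfig (Site 2)) :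
    (bondInterface D δ ω).range = Set.range (medialExplorationCurve (dobrushinData D δ) ω) := by
  rw [bondInterface, CurveClass.range_mk, range_orientCurve]

/-! ### The bond interface in a general discrete Dobrushin domain -/

/-- The **bond-percolation interface in the discrete Dobrushin domain `E`** (a square-lattice
discretisation of the Dobrushin domain `D`), as a point of the space `CurveClass ℂ` of planar
curves modulo reparametrisation: the class of G02's polygonal medial exploration curve
`medialExplorationCurve E ω` (open cluster of the wired arc `A` on its left, dual-open cluster
of the dual-wired arc `B` on its right; junk constant curve `0` unless the exploration path is
uniquely defined, which `IsZdAdmissible` guarantees), re-oriented to run from (near) `a` to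
(near) `b` by the endpoint rule `orientCurve D`. For the canonical data `E = dobrushinData D δ`
this is `bondInterface D δ` (`bondInterfaceIn_dobrushinData`). This is the interface map of the
family forms of the scaling-limit statements (with `LatticeModels.ZdDiscretisationFamily D E`).
Verbatim copy of `InterfaceScalingLimitDiscretised`'s `bondInterfaceIn`. (Smirnov, ICM 2006,
§2.1 and §2.3: the interface of the loop representation on the medial lattice, from `a` to `b`.)
[cite: Smirnov2007ICM, §2.1] -/
def bondInterfaceIn (D : DobrushinDomain) (E : DiscreteDobrushin) (ω : BondConfig (Site 2)) :
    CurveClass ℂ :=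
  CurveClass.mk (orientCurve D (medialExplorationCurve E ω))

/-- Unfolding `bondInterfaceIn`. (Smirnov, ICM 2006, §2.1.) [cite: Smirnov2007ICM, §2.1] -/
theorem bondInterfaceIn_apply (D : DobrushinDomain) (E : DiscreteDobrushin)
    (ω : BondConfig (Site 2)) :
    bondInterfaceIn D E ω = CurveClass.mk (orientCurve D (medialExplorationCurve E ω)) :=
  rfl

/-- On the canonical data `dobrushinData D δ` the interface is `bondInterface D δ`
(definitionally). (Smirnov 2001, §2.) [cite: Smirnov2001, §2] -/
@[simp] theorem bondInterfaceIn_dobrushinData (D : DobrushinDomain) (δ : ℝ) :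
    bondInterfaceIn D (dobrushinData D δ) = bondInterface D δ :=
  rfl

/-- The trace of the interface is the trace of G02's medial exploration curve (re-orientation
and passage to `CurveClass` do not change it). (Smirnov 2001, §2.) [cite: Smirnov2001, §2] -/
theorem range_bondInterfaceIn (D : DobrushinDomain) (E : DiscreteDobrushin)
    (ω : BondConfig (Site 2)) :
    (bondInterfaceIn D E ω).range = Set.range (medialExplorationCurve E ω) := by
  rw [bondInterfaceIn, CurveClass.range_mk, range_orientCurve]

/-! ### The canonical data as a discretisation family -/

/-- The canonical data `dobrushinData D` form a `ZdDiscretisationFamily` of `(D; a, b)` iff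
they are admissible for all small meshes and their discrete marked points (midpoints of the two
`A`–`B` boundary edges) converge to `{a, b}`: the domain and mesh fields hold by `rfl` and the
arcs of the data *are* `(ab)`, `(ba)` (`hausdorffEDist_self`). Verbatim copy of
`InterfaceScalingLimitDiscretised`'s `zdDiscretisationFamily_dobrushinData_iff`. (CDHKS 2014, §1,
for the notion.) [folklore] -/
theorem zdDiscretisationFamily_dobrushinData_iff (D : DobrushinDomain) :
    ZdDiscretisationFamily D (dobrushinData D) ↔
      (∀ᶠ δ in 𝓝[>] (0 : ℝ), (dobrushinData D δ).IsZdAdmissible) ∧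
        Tendsto (fun δ : ℝ ↦ Metric.hausdorffEDist
          (medialPoint δ '' (dobrushinData D δ).zdABEdges) {D.pt 0, D.pt 1}) (𝓝[>] 0) (𝓝 0) := by
  refine ⟨fun h ↦ ⟨h.eventually_isZdAdmissible, h.tendsto_zdABEdges⟩, fun h ↦ ?_⟩
  exact
    { Ω_eq := fun _ ↦ rfl
      δ_eq := fun _ ↦ rfl
      tendsto_arcA := by
        simp only [dobrushinData_arcA, Metric.hausdorffEDist_self]
        exact tendsto_const_nhds
      tendsto_arcB := by
        simp only [dobrushinData_arcB, Metric.hausdorffEDist_self]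
        exact tendsto_const_nhds
      tendsto_zdABEdges := h.2
      eventually_isZdAdmissible := h.1 }

end Literature.Probability.Percolation.Interface

/-! ### The historical names

`export` registers `Literature.Probability.Percolation.dobrushinData`, `….dobrushinData_Ω`, …,
`….bondInterfaceIn`, `….zdDiscretisationFamily_dobrushinData_iff` as aliases of the declarations
above, in this module and in every module importing it (see the module docstring). -/

namespace Literature.Probability.Percolation

export Interface (dobrushinData dobrushinData_Ω dobrushinData_δ dobrushinData_arcA
  dobrushinData_arcB reverseCurve reverseCurve_apply reverseCurve_reverseCurve orientCurve
  orientCurve_of_le orientCurve_of_lt orientCurve_eq_or range_orientCurve triInterface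
  bondInterface triInterface_apply bondInterface_apply range_triInterface range_bondInterface
  bondInterfaceIn bondInterfaceIn_apply bondInterfaceIn_dobrushinData range_bondInterfaceIn
  zdDiscretisationFamily_dobrushinData_iff)

end Literature.Probability.Percolation

end
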